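import Summits.Ventures.HodgeRepro.Groups
import Summits.Ventures.HodgeRepro.Night1ProductDischarge

/-!
# A NON-CENSUS degree-12 class under closer C5′: typer-2's twisted Pohlmann class on `A_Φ × A_{aΦ}` (`Dic₃`),
read as a corner product, discharged at `p = 12` (with Lemma R) and at `p = 24` (reduction-free)

Blind re-derivation cell `pub-hodge-repro`, seat `night-1` (gen 2).  ROUTE.md §3.4 / §3.5 places typer-2's
`TwistedCounterexample.lean` class — the `(2,2)` Pohlmann set `Δ = {(0, 1), (0, xa), (1, a⁴), (1, xa³)}` on the
twisted product `A_Φ × A_{aΦ}` of `(Dic₃, a³)`, `Φ = {1, a, a², x, xa, xa⁵}`, both factors nondegenerate and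
NON-isogenous — among the degree-12 classes OUTSIDE the face census («a non-census class with `dim B_red = 12`,
S4 open there as before»), and §4's closer table prescribes for the non-census degree-12 classes «C5′ with
`p = 9–12`».  This file makes it a kernel instance of both night-1 discharges:

* by the reduced-set dictionary (typer's `FaceReduce`: a Pohlmann set of `∏_k A_{Φ_k}` is the reduced set
  `{(cls i, s (tw i)⁻¹)}` of a corner family), `Δ` is the `s = 1` reduced set of the corner family
  `T = (Φ, Φ·(xa)⁻¹, aΦ·(a⁴)⁻¹, aΦ·(xa³)⁻¹)` — `reducedSet_eq_Δ` — which is `SumTwo` with four distinct corners,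
  distinct `(cls, tw)`, two isogeny classes (`aΦ` is no right translate of `Φ`: `twist_not_rmul`) and primitive
  representatives (`rstab = 1`), so `B_red = Simple Φ × Simple (aΦ)` has dimension `6 + 6 = 12`;
* **`twisted_weilAlgebraic`** — `Clauses 12 2 ⟹ WeilAlgebraic T` through Lemma R (`routeC_closes_face`, the
  route's `p = 12` for this class: BMM Cor 2 at `(12, 2)`, `2 ∉ ]4, 8[`, Liu at rank `13`);
* **`twisted_weilAlgebraic_prod`** — `ProdClauses 24 2 ⟹ WeilAlgebraic T` without Lemma R
  (`routeC_closes_product`, `p = dim B = 4 · 6 = 24`).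

The data are re-declared here (typer-2's file is not in the cell's tree) and certified by `decide` on the
12-element group.  Every theorem is the implication «printed clauses ⟹ the Weil line is algebraic»; BMM Cor 2 is
printed-conditional (O-R2.3).  Nothing here says anything about the status of the Hodge conjecture for CM
abelian varieties, which is NOT proved.
-/

set_option autoImplicit false

open Finset QuaternionGroup
open scoped Pointwise

namespace HodgeRepro

namespace Dic3Twisted

/-- The CM type `Φ = {1, a, a², x, xa, xa⁵}` of `(Dic₃, a³)` (typer-2's `Φ12`). -/
def Φ : Finset Dic3 := {a 0, a 1, a 2, xa 0, xa 1, xa 5}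

/-- `Φ` is a CM type of `(Dic₃, a³)`. -/
theorem Φ_isCMType : IsCMType cc_Dic3 Φ := by decide

/-- The two class representatives: `Φ` and its left Galois twist `aΦ`. -/
def reps : Fin 2 → Finset Dic3 := ![Φ, (a 1 : Dic3) • Φ]

/-- The class map: corners `0, 1` on `Φ`, corners `2, 3` on `aΦ`. -/
def cls : Fin 4 → Fin 2 := ![0, 0, 1, 1]

/-- The twists: the inverses of the second coordinates of `Δ = {(0, 1), (0, xa), (1, a⁴), (1, xa³)}`. -/
def tw : Fin 4 → Dic3 := ![(a 0)⁻¹, (xa 1)⁻¹, (a 4)⁻¹, (xa 3)⁻¹]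

/-- typer-2's Pohlmann set `Δ ⊆ Fin 2 × Dic₃`. -/
def Δ : Finset (Fin 2 × Dic3) := {(0, a 0), (0, xa 1), (1, a 4), (1, xa 3)}

/-- Both representatives are CM types. -/
theorem reps_isCMType : ∀ k, IsCMType cc_Dic3 (reps k) := by decide

/-- **The corner family is `SumTwo`**: every embedding lies in exactly two of the four corners. -/
theorem sumTwo_corner : SumTwo (corner reps cls tw) := (by decide : SumP 2 (corner reps cls tw))

/-- The four corners are pairwise distinct. -/
theorem corner_injective : Function.Injective (corner reps cls tw) := by decide

/-- The pairs `(cls i, tw i)` are pairwise distinct. -/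
theorem clsTw_injective : Function.Injective fun i => (cls i, tw i) := by decide

/-- **The dictionary**: `Δ` is the reduced set of the corner family at `s = 1` — the `s = 1` line of the Weil
class `W_F(B)` read on `B_red = A_Φ × A_{aΦ}` is typer-2's Pohlmann class `⟨Δ⟩`. -/
theorem reducedSet_eq_Δ : reducedSet cls tw 1 = Δ := by decide

/-- `Δ` is a Pohlmann set of the product type `(Φ, aΦ)` (typer-2's `Δ12_isHodgeSetProd`, re-derived here
from `SumTwo` by Lemma R's core, `isHodgeSetProd_reducedSet`). -/
theorem Δ_isHodgeSetProd : IsHodgeSetProd cc_Dic3 reps Δ := by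
  rw [← reducedSet_eq_Δ]
  exact isHodgeSetProd_reducedSet cc_Dic3_isComplexConj reps cls tw clsTw_injective sumTwo_corner 1

/-- `aΦ` is no right translate of `Φ`: the two representatives are in different isogeny classes
(typer-2's `g12_smul_ne_rmul`). -/
theorem twist_not_rmul : ∀ h : Dic3, (a 1 : Dic3) • Φ ≠ rmul Φ h := by decide

/-- `Φ` is primitive (`|rstab Φ| = 1`): `Simple Φ = A_Φ`, of dimension `6`. -/
theorem card_rstab_Φ : Fintype.card (rstab Φ) = 1 := by decide

/-- `aΦ` is primitive too. -/
theorem card_rstab_twist : Fintype.card (rstab ((a 1 : Dic3) • Φ)) = 1 := by decide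

/-- `dim B_red = 6 + 6 = 12` (R5's dimension count for the two representatives). -/
theorem dimBred_eq : (∑ k, Nat.card Dic3 / (2 * Nat.card (rstab (reps k)))) = 12 := by
  simp only [Nat.card_eq_fintype_card]
  decide

/-- **The non-census degree-12 class discharged at `p = 12` through Lemma R** (ROUTE.md §4: «non-census degree-12
classes: C5′ with p = 9–12»): the printed clauses at `(12, 2)` — BMM Cor 2 at `(12, 2)` (`2 ∉ ]4, 8[`), Liu Cor 4.20 at
rank `13`, R7, DR, Liu–Shimura, R5 on `B_red = A_Φ × A_{aΦ}` (`g = 12`), Lemma R — imply that the Weil line of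
`B = A_Φ × A_{Φ·(xa)⁻¹} × A_{aΦ·(a⁴)⁻¹} × A_{aΦ·(xa³)⁻¹}` is algebraic. -/
theorem twisted_weilAlgebraic (V : RouteC.Vocab Dic3 cc_Dic3) (H : V.Clauses 12 2) :
    V.WeilAlgebraic (corner reps cls tw) := by
  have H' : V.Clauses 12 (Fintype.card (Fin 4) / 2) := by simpa using H
  refine V.routeC_closes_face cc_Dic3_isComplexConj reps cls tw reps_isCMType sumTwo_corner clsTw_injective
    (RouteC.injOn_cosetMap_reducedSet_of_injective reps cls tw corner_injective)
    (by rw [Nat.card_eq_fintype_card]; decide) (p := 12) (by rw [dimBred_eq]) (by simp) (by norm_num) H'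

/-- **The same class without Lemma R, at `p = dim B = 24`** (`routeC_closes_product`, `ProdClauses 24 2`). -/
theorem twisted_weilAlgebraic_prod (V : RouteC.Vocab Dic3 cc_Dic3) (H : V.ProdClauses 24 2) :
    V.WeilAlgebraic (corner reps cls tw) := by
  have hsum : SumP (Fintype.card (Fin 4) / 2) (corner reps cls tw) := by
    simpa [SumP, SumTwo] using sumTwo_corner
  refine V.routeC_closes_product cc_Dic3_isComplexConj (corner reps cls tw)
    (fun i => ?_) hsum (by rw [Nat.card_eq_fintype_card]; decide) (p := 24) (by decide) (by simp)
    (by norm_num) (by simpa using H)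
  unfold corner
  exact (reps_isCMType (cls i)).rmul (tw i)

end Dic3Twisted

end HodgeRepro
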